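import Mathlib
import Literature.Analysis.ValidatedNumerics.TaylorModelIntegralCertTrig
import Literature.Analysis.ValidatedNumerics.TaylorModelExpr
import Literature.MathematicalPhysics.MHD.CerfonFreidbergSolutions
import Summits.Ventures.FusionMHD.Models.CerfonFreidbergNstxLikeQHalfDefs
import Summits.Ventures.FusionMHD.Models.CerfonFreidbergIterLikeQHalfSound
import Summits.Ventures.FusionMHD.Models.CerfonFreidbergNstxLikeAxisTight
import Summits.Ventures.FusionMHD.Models.CerfonFreidbergNstxLikeAxis
import Summits.Ventures.FusionMHD.Models.CerfonFreidbergNstxLikeShapeCert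
import HarnessLib

/-!
# Ventures/FusionMHD — Models/CerfonFreidbergNstxLikeQHalfSound.lean: SOUNDNESS of the per-panel kernel obligation of the
# certified interior `q(ψ_N = 1/2)/F` of THE Cerfon–Freidberg NSTX-like instance — what `CFNstxLike.QHalf.PanelCert.ok = true` MEANS
# (NSTX-like TWIN of `Models/CerfonFreidbergIterLikeQHalfSound.lean`, ★ #117)

HONEST FRAMING (LADDER-GRIDFUSION three columns; CF rung, F2 item R2; `pub/gridfusion/models/F2-SCOPING.md` v1.5 §9(d)).  The panel
files `…NstxLikeQHalfPanels1…9.lean` decide the Boolean `CFNstxLike.QHalf.PanelCert.ok` for all 32 panels of `t ∈ [0, 1]` (`θ = π t ∈ [0, π]`).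
This file turns each accepted panel into REAL-NUMBER STATEMENTS about THE NSTX-like instance `U = cfSolution 0 coeff`
(`Models/CerfonFreidbergNstxLikeAxisCert`).  Everything instance-independent is the ITER-like file's BY NAME: the generic program lemmas
`CFIterLike.QHalf.runF_append` / `getReg_runF_add`, the closed forms `UXc`, `UYc`, `Drc`, the evaluation block `blockG` with its symbolic
execution `blockG_regs`, the scale/half-width/centres `tmS`/`hw`/`ctr`, and the abstract-program form of the lane's check
`panelCheckT_of_parts`.  New here (instance-specific):
* §1 `params = [coeff 0, …, coeff 6, X_a, U(X_a, 0), π]` of THE NSTX-like instance and **`boxMem_params : BoxMem params qbox`** (from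
  `CFNstxLike.axZero_tight` — the tight box `Models/CerfonFreidbergNstxLikeAxisTight.lean` — and Mathlib's `Real.pi_gt_d20` / `pi_lt_d20`);
* §2 the denotations at THE instance: the APPROXIMANT `mA := progA.toFunP params` (opaque: no closed form is ever used), and
  **`progG_regs`**: the registers of `progG` run on `params` ARE `U(X_a + mA t cos πt, mA t sin πt) − U(X_a,0)/2`, `Drc coeff X_a (mA t) (πt)`,
  the polar `(6.35)` integrand `mA·(X·D_r)⁻¹·π`, and `mA` itself (register 184);
* §3 **`sound_of_ok`**: `PanelCert.ok d = true` ⇒ on panel `d.j`: the lane's integral segment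
  `FSegOK (progG.toFunP params) [1] 2⁶⁰ (2jh) (2(j+1)h) plo phi`, and for `|u| ≤ h` the flux residual at the approximant
  `|U(ray mA) − U(X_a,0)/2| ≤ eta/2⁶⁰`, `mA ∈ [mlo, mhi]/2⁶⁰`, `D_r(θ, mA) ∈ [dlo, dhi]/2⁶⁰`.
MODELLED: analytic Cerfon–Freidberg family, NSTX-like triple `(39/50, 2, 7/20)`; `q` of a MODEL surface — nothing about a device or
stability.  No `decide` beyond `rfl`-sized facts; axioms standard.  Typer/prover: gridfusion-model-5 (g8), 2026-08-27.
Citations: Freidberg 2014 §6.3.5 (6.35), §6.6.1 (6.153) [Freidberg2014]; Melquiond 2008 §3.3 [Melquiond2008]; Mahboubi–Melquiond–Sibut-Pinote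
2016 §3.2 Lemma 3, §4.1 [MahboubiMelquiondSibutpinote2016]; Joldes 2011 Alg. 2.2.10 [Joldes2011].
-/

noncomputable section

open Set
open Literature.Analysis.ValidatedNumerics Literature.Analysis.ValidatedNumerics.PolyMP
open Literature.Analysis.ValidatedNumerics.NumericsMP Literature.Analysis.ValidatedNumerics.ExpPoly
open Literature.Analysis.ODE
open Literature.MathematicalPhysics.MHD Literature.MathematicalPhysics.MHD.CerfonFreidberg
set_option autoImplicit false

namespace Summit.Ventures.FusionMHD.Models.CFNstxLike.QHalf

set_option maxRecDepth 100000

/-! ## §1 The parameters of THE NSTX-like instance and their box -/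

/-- The parameter vector of THE NSTX-like instance: `c₀…c₆` (= `coeff`), `X_a`, `U(X_a, 0)`, `π`. -/
def params : List ℝ := [coeff 0, coeff 1, coeff 2, coeff 3, coeff 4, coeff 5, coeff 6, Xa, U Xa 0, Real.pi]

/-- **THE PARAMETERS LIE IN THE BOX `qbox`** (coordinates 0–6, 8, 17 of `CFNstxLike.tightBox`; `π` by Mathlib's 20-digit bounds). -/
theorem boxMem_params : BoxMem CFNstxLike.QHalf.params CFNstxLike.QHalf.qbox := by
  have h0 := axZero_tight 0; have h1 := axZero_tight 1; have h2 := axZero_tight 2; have h3 := axZero_tight 3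
  have h4 := axZero_tight 4; have h5 := axZero_tight 5; have h6 := axZero_tight 6; have h8 := axZero_tight 8
  have h17 := axZero_tight 17
  obtain ⟨e0, e1, e2, e3, e4, e5, e6⟩ := coeffN_eq_axZero
  have eX : Xa = axZero 8 := rfl
  have eU : U Xa 0 = axZero 17 := U_axis
  have hpi1 := Real.pi_gt_d20; have hpi2 := Real.pi_lt_d20
  simp only [tightBox, Matrix.cons_val] at h0 h1 h2 h3 h4 h5 h6 h8 h17
  push_cast at h0 h1 h2 h3 h4 h5 h6 h8 h17
  unfold params qbox
  rw [e0, e1, e2, e3, e4, e5, e6, eU, eX]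
  refine boxMem_cons ?_ ?_ (boxMem_cons ?_ ?_ (boxMem_cons ?_ ?_ (boxMem_cons ?_ ?_ (boxMem_cons ?_ ?_ (boxMem_cons ?_ ?_
    (boxMem_cons ?_ ?_ (boxMem_cons ?_ ?_ (boxMem_cons ?_ ?_ (boxMem_cons ?_ ?_ boxMem_nil)))))))))
  all_goals push_cast
  all_goals
    linarith [h0.1, h0.2, h1.1, h1.2, h2.1, h2.2, h3.1, h3.2, h4.1, h4.2, h5.1, h5.2, h6.1, h6.2, h8.1, h8.2, h17.1, h17.2]

/-! ## §2 Denotations at THE NSTX-like instance -/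

/-- **THE APPROXIMANT** `m(t)` (NSTX-like): the top register of `progA` run on the instance parameters (the in-program chord-Newton ray
radius of the surface `ψ_N = 1/2` in direction `θ = π t`).  OPAQUE: nothing below uses a formula for it. -/
def mA : ℝ → ℝ := progA.toFunP params

/-- The final stack of `progA` on the instance parameters. -/
def stkA : List (ℝ → ℝ) := TProg.runF progA (constStack params)

/-- `progA` has 296 statements. -/
theorem progA_length : CFNstxLike.QHalf.progA.length = 296 := by decide

/-- The top register of `stkA` is `mA`. -/
theorem stkA_top : getReg (fun _ => (0 : ℝ)) CFNstxLike.QHalf.stkA 0 = mA := rfl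

/-- Below `progA`'s 296 pushes sit the constants. -/
theorem stkA_param (i : ℕ) :
    getReg (fun _ => (0 : ℝ)) CFNstxLike.QHalf.stkA (296 + i) = getReg (fun _ => (0 : ℝ)) (constStack params) i := by
  rw [stkA, ← progA_length]; exact CFIterLike.QHalf.getReg_runF_add _ progA _ i

/-- **THE REGISTERS OF `progG` AT THE NSTX-like INSTANCE**: residual, radial derivative, the polar `(6.35)` integrand times `π`, and `mA`. -/
theorem progG_regs (t : ℝ) :
    getReg (fun _ => (0 : ℝ)) (TProg.runF CFNstxLike.QHalf.progG (constStack params)) CFIterLike.QHalf.idxF t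
        = U (Xa + mA t * Real.cos (Real.pi * t)) (mA t * Real.sin (Real.pi * t)) - 1 / 2 * U Xa 0
    ∧ getReg (fun _ => (0 : ℝ)) (TProg.runF CFNstxLike.QHalf.progG (constStack params)) CFIterLike.QHalf.idxD t = CFIterLike.QHalf.Drc coeff Xa (mA t) (Real.pi * t)
    ∧ getReg (fun _ => (0 : ℝ)) (TProg.runF CFNstxLike.QHalf.progG (constStack params)) 0 t
        = mA t * ((Xa + mA t * Real.cos (Real.pi * t)) * CFIterLike.QHalf.Drc coeff Xa (mA t) (Real.pi * t))⁻¹ * Real.pi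
    ∧ getReg (fun _ => (0 : ℝ)) (TProg.runF CFNstxLike.QHalf.progG (constStack params)) CFIterLike.QHalf.idxM t = mA t := by
  have hrun : TProg.runF progG (constStack params) = TProg.runF CFIterLike.QHalf.blockG stkA := by rw [progG, CFIterLike.QHalf.runF_append]; rfl
  rw [hrun]
  have hP : ∀ i, getReg (fun _ => (0 : ℝ)) stkA (296 + i) = getReg (fun _ => (0 : ℝ)) (constStack params) i := stkA_param
  have h := CFIterLike.QHalf.blockG_regs stkA coeff Xa (U Xa 0) Real.pi mA stkA_top
    (by rw [hP 0]; simp [constStack, params]) (by rw [hP 1]; simp [constStack, params]) (by rw [hP 2]; simp [constStack, params])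
    (by rw [hP 3]; simp [constStack, params]) (by rw [hP 4]; simp [constStack, params]) (by rw [hP 5]; simp [constStack, params])
    (by rw [hP 6]; simp [constStack, params]) (by rw [hP 7]; simp [constStack, params]) (by rw [hP 8]; simp [constStack, params])
    (by rw [hP 9]; simp [constStack, params]) t
  obtain ⟨hF, h4, h3, h0⟩ := h
  refine ⟨?_, ?_, ?_, ?_⟩
  · rw [show CFIterLike.QHalf.idxF = 110 from rfl, hF]; rfl
  · rw [show CFIterLike.QHalf.idxD = 4 from rfl, h4]
  · rw [h0, h3, h4]
  · rw [show CFIterLike.QHalf.idxM = 184 from rfl, show (184 : ℕ) = CFIterLike.QHalf.blockG.length + 0 by rw [CFIterLike.QHalf.blockG_length], CFIterLike.QHalf.getReg_runF_add, stkA_top]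

/-! ## §3 Soundness of the per-panel obligation -/

/-- The flux RESIDUAL of the approximant (NSTX-like): `U(X_a + m cos θ, m sin θ) − U(X_a, 0)/2` at `θ = π t`. -/
def resid (t : ℝ) : ℝ := U (Xa + mA t * Real.cos (Real.pi * t)) (mA t * Real.sin (Real.pi * t)) - 1 / 2 * U Xa 0

/-- The radial derivative ALONG THE APPROXIMANT (NSTX-like): `D_r(π t, m t)`. -/
def DrA (t : ℝ) : ℝ := CFIterLike.QHalf.Drc coeff Xa (mA t) (Real.pi * t)

/-- From scaled-integer range claims to real bounds on a register of the NSTX-like program (via `bounds_of_tmem`). -/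
theorem reg_bounds {j i : ℕ} {W : IPoly} {lo hi : ℤ}
    (hW : TMem CFIterLike.QHalf.tmS CFIterLike.QHalf.hw (fun u => getReg (fun _ => (0 : ℝ)) (TProg.runF CFNstxLike.QHalf.progG (constStack params)) i ((CFIterLike.QHalf.ctr j : ℝ) + u)) W)
    (hlo : lo ≤ tlowerI CFIterLike.QHalf.tmS CFIterLike.QHalf.hw W) (hhi : tupperI CFIterLike.QHalf.tmS CFIterLike.QHalf.hw W ≤ hi) {u : ℝ} (hu : |u| ≤ CFIterLike.QHalf.hw) :
    ((lo : ℝ) / CFIterLike.QHalf.tmS) ≤ getReg (fun _ => (0 : ℝ)) (TProg.runF CFNstxLike.QHalf.progG (constStack params)) i ((CFIterLike.QHalf.ctr j : ℝ) + u)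
      ∧ getReg (fun _ => (0 : ℝ)) (TProg.runF CFNstxLike.QHalf.progG (constStack params)) i ((CFIterLike.QHalf.ctr j : ℝ) + u) ≤ ((hi : ℝ) / CFIterLike.QHalf.tmS) := by
  have hS : ((CFIterLike.QHalf.tmS : ℕ) : ℚ) ≠ 0 := by exact_mod_cast CFIterLike.QHalf.tmS_pos.ne'
  have h := bounds_of_tmem CFIterLike.QHalf.tmS_pos CFIterLike.QHalf.hw_pos.le hW (lo := (lo : ℚ) / CFIterLike.QHalf.tmS) (hi := (hi : ℚ) / CFIterLike.QHalf.tmS)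
    (by rw [div_mul_cancel₀ _ hS]; exact_mod_cast hlo) (by rw [div_mul_cancel₀ _ hS]; exact_mod_cast hhi) hu
  push_cast at h
  exact h

/-- **SOUNDNESS OF `CFNstxLike.QHalf.PanelCert.ok`.**  If the kernel accepts panel `d.j`, then (i) the lane's integral segment of the
polar integrand program holds with the claimed bounds, and for every `|u| ≤ h`, at `t = (2j+1)h + u`: (ii) `|resid t| ≤ eta/2⁶⁰`,
(iii) `mA t ∈ [mlo, mhi]/2⁶⁰`, (iv) `DrA t ∈ [dlo, dhi]/2⁶⁰`. -/
theorem sound_of_ok {d : CFNstxLike.QHalf.PanelCert} (h : d.ok = true) :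
    FSegOK (progG.toFunP params) [1] CFIterLike.QHalf.tmS (panelLeft CFIterLike.QHalf.hw d.j) (panelLeft CFIterLike.QHalf.hw (d.j + 1)) d.plo d.phi
    ∧ (∀ u : ℝ, |u| ≤ CFIterLike.QHalf.hw → |resid ((CFIterLike.QHalf.ctr d.j : ℝ) + u)| ≤ (d.eta : ℝ) / CFIterLike.QHalf.tmS)
    ∧ (∀ u : ℝ, |u| ≤ CFIterLike.QHalf.hw → ((d.mlo : ℝ) / CFIterLike.QHalf.tmS) ≤ mA ((CFIterLike.QHalf.ctr d.j : ℝ) + u) ∧ mA ((CFIterLike.QHalf.ctr d.j : ℝ) + u) ≤ ((d.mhi : ℝ) / CFIterLike.QHalf.tmS))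
    ∧ (∀ u : ℝ, |u| ≤ CFIterLike.QHalf.hw → ((d.dlo : ℝ) / CFIterLike.QHalf.tmS) ≤ DrA ((CFIterLike.QHalf.ctr d.j : ℝ) + u) ∧ DrA ((CFIterLike.QHalf.ctr d.j : ℝ) + u) ≤ ((d.dhi : ℝ) / CFIterLike.QHalf.tmS)) := by
  simp only [PanelCert.ok, Bool.and_eq_true, decide_eq_true_eq] at h
  obtain ⟨⟨⟨⟨⟨⟨⟨⟨hok, hplo⟩, hphi⟩, hFlo⟩, hFhi⟩, hmlo⟩, hmhi⟩, hdlo⟩, hdhi⟩ := h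
  unfold panelModels at hok hplo hphi hFlo hFhi hmlo hmhi hdlo hdhi
  have hst := TProg.stackMem_model CFIterLike.QHalf.tmS_pos CFIterLike.QHalf.hw_pos.le (CFIterLike.QHalf.ctr d.j) progG (stackMem_const CFIterLike.QHalf.tmS CFIterLike.QHalf.hw (CFIterLike.QHalf.ctr d.j) boxMem_params) _ hok
  rw [← CFIterLike.QHalf.pc_eq] at hok hplo hphi
  refine ⟨fsegOK_of_panelCheckT (CFIterLike.QHalf.panelCheckT_of_parts CFIterLike.QHalf.tmS_pos CFIterLike.QHalf.hw_pos hok hplo hphi) boxMem_params, ?_, ?_, ?_⟩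
  · intro u hu
    have hb := reg_bounds (hst CFIterLike.QHalf.idxF) hFlo hFhi hu
    rw [(progG_regs _).1] at hb
    rw [resid, abs_le]
    push_cast at hb
    rw [neg_div] at hb
    exact hb
  · intro u hu
    have hb := reg_bounds (hst CFIterLike.QHalf.idxM) hmlo hmhi hu
    rwa [(progG_regs _).2.2.2] at hb
  · intro u hu
    have hb := reg_bounds (hst CFIterLike.QHalf.idxD) hdlo hdhi hu
    rw [(progG_regs _).2.1] at hb
    exact hb

/-- **The integrand certified by the integral segment IS the polar `(6.35)` integrand along the NSTX-like approximant, times `π`.** -/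
theorem progG_toFunP (t : ℝ) :
    CFNstxLike.QHalf.progG.toFunP params t = mA t * ((Xa + mA t * Real.cos (Real.pi * t)) * DrA t)⁻¹ * Real.pi := by
  unfold TProg.toFunP
  rw [(progG_regs t).2.2.1]
  rfl

end Summit.Ventures.FusionMHD.Models.CFNstxLike.QHalf

end
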